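import Literature.MathematicalPhysics.QuantumFieldTheory.Balaban1983to89.B4Lower18
import Literature.MathematicalPhysics.QuantumFieldTheory.Balaban1983to89.B4TorusPositivity

/-!
# NE7K1LinFoldKernels — row NE7 (node U5), candidate route HOM, path H1L, cell K1-lin(s): THE DOUBLED TORUS OVER A NEUMANN BOX —
# periodised nearest-neighbour kernel, the fold `𝕋(2N) → Π(N)`, and the two lattice facts behind I2: «periodic folds to Neumann»
# and «blocks fold onto blocks, one torus block over each (block, image) pair» (NEEDS-ESTIMATE #E1, input I2 — lattice half)

Lineage `b2b-balaban-t4-ne7-p2` (CRUX PROVER NE7 #2), generation 72; file 31 (kernel-level companion of file 30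
`NE7K1LinSchurFold`).  Everything here lives on `ℤ^{d+1}` with the B4 cell's `boxDom`, `foldBox`, `reflBox`, `nbrs`, `lapK`, `blk`
(`B4Reflection242`) and `wrap` (`B4TorusPositivity`); the doubled torus `𝕋 = Π_μ ℤ∕2N_μ` is carried by its representatives
`boxDom (dbl N)`, `dbl N = 2N`.

* §1 `foldBox_wrap` (folding forgets the reduction mod `2N`), `wrap_add_eq_iff`.
* §2 THE PERIODISED ADJACENCY `tadj N x y = #{z ∈ nbrs x : z ≡ y (mod 2N)}` (with multiplicity): symmetric on representatives
  (`tadj_comm`), total degree `2(d+1)` (`sum_tadj`), dominates the Neumann adjacency of the box `boxDom (dbl N)`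
  (`one_le_tadj_of_mem_nbrs`), and **`sum_tadj_indicator`**: `Σ_{l ∈ 𝕋} tadj(x,l)·[fold l = y] = #{z ∈ nbrs x : fold z = y}`.
* §3 **`foldLap_eq`** — PERIODIC FOLDS TO NEUMANN at the level of entries: for every lattice point `x` and box point `y`,
  `2(d+1)·[fold x = y] − #{z ∈ nbrs x : fold z = y} = (−Δ^N_{Π})(fold x, y)` (the tree's `foldOp_lapK` at `fold x`, transported
  along the deck transformation `x = σ(fold x)` by `lapK`'s reflection invariance).
* §4 BLOCKS: `blk_foldBox` (`blk_b ∘ fold_{bK} = fold_K ∘ blk_b` — blocks fold onto blocks), `image_blk_boxDom`,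
  `mem_boxDom_mul_iff`, and **`card_fibre_blk`**: over a coarse torus point `β′` and a fine box point `y` there is EXACTLY ONE
  fine torus point with block label `β′` folding onto `y` when `fold β′ = blk y`, and none otherwise (freeness `reflBox_inj` +
  transitivity `reflBox_foldBox` of the image maps).

HONEST FRAMING: [folklore] lattice bookkeeping; no estimate; nothing of Bałaban's asserted; no `sorry`.  Census only (I2's
lattice half); NE7 NOT PRINTED ∕ NOT PROVED; spine 0∕9; FIXED FINITE T⁴, rung (B)+1; NOT infinite volume, NOT mass gap, NOT
Clay.  HONEST DEPENDENCY: continuum YM on T⁴ ⇐ BetaPertH ∧ nine spine estimates (0/9 proved); BetaPertH ⇐ (D1) ∧ (D4) ∧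
CAP+tail; G-an2-4 gates asym, D1 and NE2/3/4.
-/

noncomputable section

open Finset

namespace Summit.QuantumFields.BalabanUV.T4Continuum.NE7K1LinFoldKernels

open Literature.MathematicalPhysics.QuantumFieldTheory.Balaban1983to89
open Literature.MathematicalPhysics.QuantumFieldTheory.Balaban1983to89.B4Reflection242
open Literature.MathematicalPhysics.QuantumFieldTheory.Balaban1983to89.B4TorusPositivity (wrap wrap_mem_box
  wrap_eq_self_of_mem wrap_wrap_add)
open Literature.MathematicalPhysics.QuantumFieldTheory.Balaban1983to89.B4Lower18 (fineDom_boxDom mem_fineDom neumannLapR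
  neumannLapR_boxDom)

variable {d : ℕ}

/-! ### §1 The doubled period, reduction and folding -/

/-- the side lengths `2N_μ` of the doubled torus over the box `Π_μ[0, N_μ)`. [folklore] -/
def dbl (N : Fin (d + 1) → ℕ) : Fin (d + 1) → ℕ := fun i => 2 * N i

/-- unfolding lemma for `dbl`. [folklore] -/
@[simp] theorem dbl_apply (N : Fin (d + 1) → ℕ) (i : Fin (d + 1)) : dbl N i = 2 * N i := rfl

/-- the doubled sides are positive. [folklore] -/
theorem dbl_pos {N : Fin (d + 1) → ℕ} (hN : ∀ i, 1 ≤ N i) : ∀ i, 1 ≤ dbl N i := fun i => by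
  have := hN i; simp only [dbl_apply]; omega

/-- doubling commutes with refining the blocks: `dbl (b·K) = b·dbl K`. [folklore] -/
theorem dbl_mul (b : ℕ) (K : Fin (d + 1) → ℕ) : dbl (fun i => b * K i) = fun i => b * dbl K i :=
  funext fun i => by simp only [dbl_apply]; ring

/-- the representative mod `P` lies in the period box. [folklore] -/
theorem wrap_mem_boxDom {P : Fin (d + 1) → ℕ} (hP : ∀ i, 1 ≤ P i) (z : Fin (d + 1) → ℤ) : wrap P z ∈ boxDom P :=
  wrap_mem_box hP z

/-- points of the period box are their own representatives. [folklore] -/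
theorem wrap_eq_self {P : Fin (d + 1) → ℕ} {z : Fin (d + 1) → ℤ} (hz : z ∈ boxDom P) : wrap P z = z :=
  wrap_eq_self_of_mem hz

/-- `fold1` forgets the reduction mod `2N`. [folklore] -/
theorem fold1_emod (N : ℕ) (n : ℤ) : fold1 N (n % (2 * N : ℤ)) = fold1 N n := by
  unfold fold1
  rw [Int.emod_emod_of_dvd _ (dvd_refl _)]

/-- **FOLDING FORGETS THE REDUCTION mod `2N`**: `fold (z mod 2N) = fold z`. [folklore] -/
theorem foldBox_wrap (N : Fin (d + 1) → ℕ) (z : Fin (d + 1) → ℤ) : foldBox N (wrap (dbl N) z) = foldBox N z := by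
  funext i
  simp only [foldBox_apply, wrap, dbl_apply]
  push_cast
  exact fold1_emod (N i) (z i)

/-- on the period box, `y ≡ x + v` iff `x ≡ y − v`. [folklore] -/
theorem wrap_add_eq_iff {P : Fin (d + 1) → ℕ} {x y v : Fin (d + 1) → ℤ} (hx : x ∈ boxDom P) (hy : y ∈ boxDom P) :
    wrap P (x + v) = y ↔ wrap P (y - v) = x := by
  constructor
  · intro h; rw [← h, sub_eq_add_neg, wrap_wrap_add, add_neg_cancel_right, wrap_eq_self hx]
  · intro h; rw [← h, wrap_wrap_add, sub_add_cancel, wrap_eq_self hy]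

/-! ### §2 The periodised nearest-neighbour kernel on representatives -/

/-- **TORUS ADJACENCY WITH MULTIPLICITY** on the representatives `boxDom (dbl N)` of `𝕋 = Π_μ ℤ∕2N_μ`: the number of lattice
neighbours of `x` that reduce to `y` (the periodisation `Σ_m [x ~ y + 2Nm]` of the nearest-neighbour kernel). [folklore] -/
def tadj (N : Fin (d + 1) → ℕ) (x y : Fin (d + 1) → ℤ) : ℕ := ((nbrs x).filter fun z => wrap (dbl N) z = y).card

/-- the periodised adjacency is SYMMETRIC on representatives (`z ↦ x + y − z` exchanges the two neighbour sets). [folklore] -/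
theorem tadj_comm {N : Fin (d + 1) → ℕ} {x y : Fin (d + 1) → ℤ} (hx : x ∈ boxDom (dbl N)) (hy : y ∈ boxDom (dbl N)) :
    tadj N x y = tadj N y x := by
  classical
  unfold tadj
  refine Finset.card_nbij' (fun z => x + y - z) (fun z => y + x - z) ?_ ?_ (fun z _ => by funext j; simp; ring)
    (fun z _ => by funext j; simp; ring)
  · intro z hz
    simp only [Finset.mem_coe, Finset.mem_filter] at hz ⊢
    obtain ⟨hz, hw⟩ := hz
    refine ⟨?_, ?_⟩
    · rw [mem_nbrs_iff_sub] at hz ⊢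
      obtain ⟨i, hi | hi⟩ := hz
      · exact ⟨i, Or.inr (by rw [← hi]; funext j; simp; ring)⟩
      · refine ⟨i, Or.inl ?_⟩
        rw [show x + y - z - y = -(z - x) by funext j; simp; ring, hi, neg_neg]
    · have e : x + y - z = y - (z - x) := by funext j; simp; ring
      rw [e, ← wrap_add_eq_iff hx hy, add_sub_cancel, hw]
  · intro z hz
    simp only [Finset.mem_coe, Finset.mem_filter] at hz ⊢
    obtain ⟨hz, hw⟩ := hz
    refine ⟨?_, ?_⟩
    · rw [mem_nbrs_iff_sub] at hz ⊢
      obtain ⟨i, hi | hi⟩ := hz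
      · exact ⟨i, Or.inr (by rw [← hi]; funext j; simp; ring)⟩
      · refine ⟨i, Or.inl ?_⟩
        rw [show y + x - z - x = -(z - y) by funext j; simp; ring, hi, neg_neg]
    · have e : y + x - z = x - (z - y) := by funext j; simp; ring
      rw [e, ← wrap_add_eq_iff hy hx, add_sub_cancel, hw]

/-- the total periodised degree is `2(d+1)` (every neighbour reduces to exactly one representative). [folklore] -/
theorem sum_tadj {N : Fin (d + 1) → ℕ} (hN : ∀ i, 1 ≤ N i) (x : Fin (d + 1) → ℤ) :
    ∑ y ∈ boxDom (dbl N), tadj N x y = 2 * (d + 1) := by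
  unfold tadj
  rw [← Finset.card_eq_sum_card_fiberwise fun z _ => wrap_mem_boxDom (dbl_pos hN) z, card_nbrs]

/-- the periodised adjacency DOMINATES the box adjacency: a lattice neighbour `y ∈ 𝕋` of `x` reduces to itself. [folklore] -/
theorem one_le_tadj_of_mem_nbrs {N : Fin (d + 1) → ℕ} {x y : Fin (d + 1) → ℤ} (hy : y ∈ boxDom (dbl N)) (hxy : y ∈ nbrs x) :
    1 ≤ tadj N x y := by
  unfold tadj
  exact Finset.card_pos.2 ⟨y, Finset.mem_filter.2 ⟨hxy, wrap_eq_self hy⟩⟩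

/-- the periodised degree as a sum of indicators. [folklore] -/
theorem tadj_eq_sum (N : Fin (d + 1) → ℕ) (x y : Fin (d + 1) → ℤ) :
    (tadj N x y : ℝ) = ∑ z ∈ nbrs x, if wrap (dbl N) z = y then (1 : ℝ) else 0 := by
  rw [tadj, Finset.sum_boole]

/-- **THE FIBREWISE COUNT**: `Σ_{l ∈ 𝕋} tadj(x, l)·[fold l = y] = #{z ∈ nbrs x : fold z = y}` (reduce, then fold = fold).
[folklore] -/
theorem sum_tadj_indicator {N : Fin (d + 1) → ℕ} (hN : ∀ i, 1 ≤ N i) (x y : Fin (d + 1) → ℤ) :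
    ∑ l ∈ boxDom (dbl N), (tadj N x l : ℝ) * (if foldBox N l = y then (1 : ℝ) else 0) =
      (((nbrs x).filter fun z => foldBox N z = y).card : ℝ) := by
  simp_rw [tadj_eq_sum, Finset.sum_mul]
  rw [Finset.sum_comm]
  have key : ∀ z ∈ nbrs x, ∑ l ∈ boxDom (dbl N), (if wrap (dbl N) z = l then (1 : ℝ) else 0) *
      (if foldBox N l = y then (1 : ℝ) else 0) = if foldBox N z = y then 1 else 0 := by
    intro z _
    have h1 : ∀ l, (if wrap (dbl N) z = l then (1 : ℝ) else 0) * (if foldBox N l = y then (1 : ℝ) else 0) =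
        if wrap (dbl N) z = l then (if foldBox N l = y then 1 else 0) else 0 := by
      intro l; split_ifs <;> simp
    simp_rw [h1]
    rw [Finset.sum_ite_eq, if_pos (wrap_mem_boxDom (dbl_pos hN) z), foldBox_wrap]
  rw [Finset.sum_congr rfl key, Finset.sum_boole]

/-! ### §3 Periodic folds to Neumann: the folded free Laplacian at an arbitrary lattice point -/

/-- the lattice Laplacian kernel is invariant under the image maps (real form of the tree's `lapK_reflBox`). [folklore] -/
theorem lapK_reflBox_real (N : Fin (d + 1) → ℕ) (ε : Fin (d + 1) → Bool) (m x z : Fin (d + 1) → ℤ) :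
    (lapK (reflBox N ε m x) (reflBox N ε m z) : ℝ) = lapK x z := by
  simp only [lapK, (reflBox N ε m).injective.eq_iff, mem_nbrs_reflBox_iff]

/-- the neighbours of `σx` folding onto `y` are the images of the neighbours of `x` folding onto `y`. [folklore] -/
theorem card_nbrs_fold_reflBox {N : Fin (d + 1) → ℕ} (hN : ∀ i, 1 ≤ N i) (ε : Fin (d + 1) → Bool)
    (m x y : Fin (d + 1) → ℤ) :
    ((nbrs (reflBox N ε m x)).filter fun z => foldBox N z = y).card = ((nbrs x).filter fun z => foldBox N z = y).card := by
  classical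
  symm
  refine Finset.card_nbij' (fun z => reflBox N ε m z) (fun z => (reflBox N ε m).symm z) ?_ ?_
    (fun z _ => Equiv.symm_apply_apply _ _) (fun z _ => Equiv.apply_symm_apply _ _)
  · intro z hz
    rw [Finset.mem_coe, Finset.mem_filter] at hz ⊢
    exact ⟨(mem_nbrs_reflBox_iff N ε m).2 hz.1, by rw [foldBox_reflBox hN, hz.2]⟩
  · intro w hw
    rw [Finset.mem_coe, Finset.mem_filter] at hw ⊢
    have e : reflBox N ε m ((reflBox N ε m).symm w) = w := Equiv.apply_symm_apply _ _
    refine ⟨?_, ?_⟩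
    · rw [← mem_nbrs_reflBox_iff N ε m, e]; exact hw.1
    · rw [← foldBox_reflBox hN ε m, e]; exact hw.2

/-- the folded free Laplacian at a BOX point, as a count: `2(d+1)·[x₀ = y] − #{z ∈ nbrs x₀ : fold z = y} = (−Δ^N_Π)(x₀, y)`
(the tree's `foldOp_lapK`, unfolded). [folklore] -/
theorem foldLap_eq_of_mem {N : Fin (d + 1) → ℕ} (hN : ∀ i, 1 ≤ N i) {x₀ y : Fin (d + 1) → ℤ} (hx₀ : x₀ ∈ boxDom N)
    (hy : y ∈ boxDom N) :
    2 * ((d : ℝ) + 1) * (if x₀ = y then (1 : ℝ) else 0) - (((nbrs x₀).filter fun z => foldBox N z = y).card : ℝ) =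
      neumannLapR (boxDom N) x₀ y := by
  classical
  have h := foldOp_lapK (R := ℝ) hN hx₀ hy
  rw [neumannLapR_boxDom, ← h]
  unfold ImageSystem.foldOp
  have hfx : foldBox N x₀ = x₀ := (mem_boxDom_iff_fold hN x₀).1 hx₀
  rw [box_fold, Finset.filter_insert, hfx]
  have hnb : ∑ z ∈ (nbrs x₀).filter (fun z => foldBox N z = y), (lapK x₀ z : ℝ) =
      -((((nbrs x₀).filter fun z => foldBox N z = y).card : ℕ) : ℝ) := by
    rw [Finset.sum_congr rfl (g := fun _ => (-1 : ℝ)), Finset.sum_const, nsmul_eq_mul, mul_neg_one]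
    intro z hz
    have hz' := (Finset.mem_filter.1 hz).1
    have hne : z ≠ x₀ := fun h => not_mem_nbrs_self x₀ (h ▸ hz')
    simp [lapK, hne, hz']
  by_cases hxy : x₀ = y
  · rw [if_pos hxy, if_pos hxy, Finset.sum_insert (fun h' => not_mem_nbrs_self x₀ (Finset.mem_filter.1 h').1), hnb]
    simp only [lapK, if_true]
    push_cast
    ring
  · rw [if_neg hxy, if_neg hxy, hnb]
    ring

/-- **PERIODIC FOLDS TO NEUMANN, at every lattice point**: `2(d+1)·[fold x = y] − #{z ∈ nbrs x : fold z = y} = (−Δ^N_Π)(fold x, y)`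
— transport of `foldLap_eq_of_mem` along `x = σ(fold x)`. [folklore] -/
theorem foldLap_eq {N : Fin (d + 1) → ℕ} (hN : ∀ i, 1 ≤ N i) (x : Fin (d + 1) → ℤ) {y : Fin (d + 1) → ℤ}
    (hy : y ∈ boxDom N) :
    2 * ((d : ℝ) + 1) * (if foldBox N x = y then (1 : ℝ) else 0) - (((nbrs x).filter fun z => foldBox N z = y).card : ℝ) =
      neumannLapR (boxDom N) (foldBox N x) y := by
  have hx₀ : foldBox N x ∈ boxDom N := foldBox_mem_boxDom hN x
  rw [← foldLap_eq_of_mem hN hx₀ hy]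
  congr 2
  conv_lhs => rw [← reflBox_foldBox N x]
  exact_mod_cast congrArg (fun n : ℕ => (n : ℝ)) (card_nbrs_fold_reflBox hN (bitsOf N x) (mulsOf N x) (foldBox N x) y)

/-! ### §4 Blocks: labels fold like points, and the fibre count over a (label, image) pair -/

/-- a point lies in the box of `b·K_μ` sites iff its `b`-block label lies in the box of `K_μ` labels. [folklore] -/
theorem mem_boxDom_mul_iff {b : ℕ} (hb : 1 ≤ b) {K : Fin (d + 1) → ℕ} {x : Fin (d + 1) → ℤ} :
    x ∈ boxDom (fun i => b * K i) ↔ blk b x ∈ boxDom K := by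
  rw [← fineDom_boxDom hb, mem_fineDom hb]

/-- the block labels of the box of `b·K_μ` sites form the box of `K_μ` labels. [folklore] -/
theorem image_blk_boxDom {b : ℕ} (hb : 1 ≤ b) (K : Fin (d + 1) → ℕ) :
    (boxDom (fun i => b * K i)).image (blk b) = boxDom K := by
  classical
  ext β
  simp only [Finset.mem_image]
  constructor
  · rintro ⟨x, hx, rfl⟩; exact (mem_boxDom_mul_iff hb).1 hx
  · intro hβ
    refine ⟨fun i => (b : ℤ) * β i, ?_, blk_mul hb β⟩
    rw [mem_boxDom_mul_iff hb, blk_mul hb]; exact hβ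

/-- **BLOCKS FOLD ONTO BLOCKS**: `blk_b (fold_{bK} x) = fold_K (blk_b x)` (the mirrors of the fine box sit on block faces).
[folklore] -/
theorem blk_foldBox {b : ℕ} (hb : 1 ≤ b) {K : Fin (d + 1) → ℕ} (hK : ∀ i, 1 ≤ K i) (x : Fin (d + 1) → ℤ) :
    blk b (foldBox (fun i => b * K i) x) = foldBox K (blk b x) := by
  have hN : ∀ i, 1 ≤ (fun i => b * K i) i := fun i => Nat.one_le_iff_ne_zero.2 (Nat.mul_ne_zero (by omega)
    (by have := hK i; omega))
  set x₀ := foldBox (fun i => b * K i) x with hx₀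
  have hx : reflBox (fun i => b * K i) (bitsOf (fun i => b * K i) x) (mulsOf (fun i => b * K i) x) x₀ = x :=
    reflBox_foldBox _ x
  have hmem : blk b x₀ ∈ boxDom K := blk_mem_boxDom hb (foldBox_mem_boxDom hN x)
  conv_rhs => rw [← hx, blk_reflBox_mul hb, foldBox_reflBox hK]
  exact ((mem_boxDom_iff_fold hK _).1 hmem).symm

/-- **THE FIBRE COUNT OVER A (LABEL, IMAGE) PAIR**: for a coarse torus point `β′ ∈ boxDom (dbl K)` and a fine box point
`y ∈ boxDom (bK)`, exactly one fine torus point has `b`-block label `β′` and folds onto `y` when `fold_K β′ = blk_b y`, none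
otherwise. [folklore] -/
theorem card_fibre_blk {b : ℕ} (hb : 1 ≤ b) {K : Fin (d + 1) → ℕ} (hK : ∀ i, 1 ≤ K i) {β' y : Fin (d + 1) → ℤ}
    (hβ' : β' ∈ boxDom (dbl K)) (hy : y ∈ boxDom (fun i => b * K i)) :
    ((boxDom (dbl fun i => b * K i)).filter fun x' => blk b x' = β' ∧ foldBox (fun i => b * K i) x' = y).card =
      if foldBox K β' = blk b y then 1 else 0 := by
  classical
  have hN : ∀ i, 1 ≤ (fun i => b * K i) i := fun i => Nat.one_le_iff_ne_zero.2 (Nat.mul_ne_zero (by omega)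
    (by have := hK i; omega))
  have hfy : foldBox (fun i => b * K i) y = y := (mem_boxDom_iff_fold hN y).1 hy
  split_ifs with h
  · -- the unique point: the image of `y` under the deck transformation carrying `fold β′` to `β′`
    set ε := bitsOf K β'
    set m := mulsOf K β'
    have hβ : reflBox K ε m (blk b y) = β' := by rw [← h]; exact reflBox_foldBox K β'
    set x₀ := reflBox (fun i => b * K i) ε m y with hx₀
    have hblk : blk b x₀ = β' := by rw [hx₀, blk_reflBox_mul hb, hβ]
    have hfold : foldBox (fun i => b * K i) x₀ = y := by rw [hx₀, foldBox_reflBox hN, hfy]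
    have hmem : x₀ ∈ boxDom (dbl fun i => b * K i) := by
      rw [dbl_mul, mem_boxDom_mul_iff hb, hblk]; exact hβ'
    rw [Finset.card_eq_one]
    refine ⟨x₀, Finset.eq_singleton_iff_unique_mem.2 ⟨Finset.mem_filter.2 ⟨hmem, hblk, hfold⟩, fun x' hx' => ?_⟩⟩
    obtain ⟨-, h1, h2⟩ := Finset.mem_filter.1 hx'
    have e := reflBox_foldBox (fun i => b * K i) x'
    rw [h2] at e
    have h3 : reflBox K (bitsOf (fun i => b * K i) x') (mulsOf (fun i => b * K i) x') (blk b y) = reflBox K ε m (blk b y) := by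
      rw [← blk_reflBox_mul hb, e, h1, hβ]
    obtain ⟨h4, h5⟩ := reflBox_inj hK (blk b y) h3
    rw [← e, h4, h5]
  · rw [Finset.card_eq_zero, Finset.eq_empty_iff_forall_notMem]
    intro x' hx'
    obtain ⟨-, h1, h2⟩ := Finset.mem_filter.1 hx'
    apply h
    rw [← h1, ← blk_foldBox hb hK, h2]

end Summit.QuantumFields.BalabanUV.T4Continuum.NE7K1LinFoldKernels

end
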